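import Summits.Ventures.LatticeQCDFlow.Scoring.HalvesTest

/-!
# The between-replica error is unbiased for the variance of the replica mean — and conservative when the replicas' true values differ

HONEST FRAMING: exact (Metropolis-corrected) sampling algorithms for lattice gauge theory;
figures of merit are autocorrelation/cost numbers at stated couplings and volumes; no
continuum-physics claim.

Venture `LatticeQCDFlow` (cell pub-lqcd), sub-topic `Scoring`; FANOUT row 11 (`eng-scorerA`,
fitness scorer A).  NEW WORK of the cell (second-moment algebra on a probability space with
Mathlib's `variance` / `covariance`); textbook content (unbiasedness of the sample variance for
uncorrelated equal-mean variables), our own proof, nothing cited as a tree fact.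

## Where the replica error enters the cell

* scorer A 0.1.2 prints, beside the Γ-method `tau_int`, a replica estimate `tau_rep = s²_R/(2 Γ̂(0))`
  from the scatter of the per-stream means (gamma.py `uwerr`, `R ≥ 2` streams) and uses it in the
  `window-underestimate` guard; scorer B 0.1.8's `n_eff_replicas` is the jackknife-over-replicas
  version (docket L2-A12, D-B9 — 'estimator choice');
* LEAD RO-23 (5): training SEEDS of one recipe are replicas of one arm; the default combination is
  the unweighted seed mean with error `max(statistical, half the seed range)`
  (`Scoring/SeedCombination`: half-range ≥ the between-seed standard error, deterministically).

This file supplies the POPULATION statement behind the between-replica standard error.  With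
replicas `Y₀ … Y_{R−1}` (square integrable, pairwise UNCORRELATED — independent streams / seeds),
means `m_r = E Y_r`, replica mean `Ȳ = (1/R) Σ Y_r` and the statistic
`SE² := Σ_r (Y_r − Ȳ)² / (R (R − 1))`:

* `sum_sq_sub_avg` — the algebra `Σ_r (y_r − ȳ)² = Σ_r y_r² − R ȳ²` (pointwise and for the means);
* `variance_replicaMean` — `Var(Ȳ) = (1/R²) Σ_r Var(Y_r)` (uncorrelated, any means, any variances);
* **`integral_replicaSEsq`** — `E[SE²] = Var(Ȳ) + Σ_r (m_r − m̄)² / (R (R − 1))`, EXACTLY;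
* `integral_replicaSEsq_of_means_eq` — equal true means (genuine replicas of ONE arm) ⇒
  **`E[SE²] = Var(Ȳ)`: the between-replica squared standard error is unbiased for the variance of
  the replica mean**, whatever the (possibly different) replica variances and whatever the
  within-replica autocorrelation (it never enters: only the replica MEANS are used) — this is why a
  replica/seed error needs no window and no `τ`;
* `variance_replicaMean_le_integral_replicaSEsq` — unequal true means (the 'replicas' are in fact
  different arms, e.g. differently trained models) ⇒ `E[SE²] ≥ Var(Ȳ)`: the replica error is then
  CONSERVATIVE in expectation, never anti-conservative.

What is NOT here: the sampling distribution of `SE²` (its own relative scatter ≈ `√(2/(R−1))` needs a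
Gaussian model — the reason READ-windowing-row16-E2.md advised `R ≥ 4`), and the link
`Var(Y_r) = 2 τ_n σ²/n` for a replica that is itself a mean of `n` correlated samples
(`Scoring/VarianceOfTheMean.variance_mean_range_of_cov_eq`).
-/

namespace Summit.Ventures.LatticeQCDFlow.Scoring

open Finset MeasureTheory ProbabilityTheory
open scoped BigOperators

/-! ### Algebra: `Σ (y_r − ȳ)² = Σ y_r² − R ȳ²` -/

/-- For reals `y₀ … y_{R−1}` with average `ȳ = (Σ y_r)/R` (`R ≥ 1`):
`Σ_r (y_r − ȳ)² = Σ_r y_r² − R ȳ²`. -/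
theorem sum_sq_sub_avg (y : ℕ → ℝ) {R : ℕ} (hR : R ≠ 0) :
    ∑ r ∈ range R, (y r - (∑ s ∈ range R, y s) / R) ^ 2
      = ∑ r ∈ range R, y r ^ 2 - R * ((∑ s ∈ range R, y s) / R) ^ 2 := by
  have hR' : (R : ℝ) ≠ 0 := by exact_mod_cast hR
  set S := ∑ s ∈ range R, y s with hS
  have hexp : ∀ r ∈ range R, (y r - S / R) ^ 2 = y r ^ 2 - 2 * (S / R) * y r + (S / R) ^ 2 := by
    intro r _; ring
  rw [Finset.sum_congr rfl hexp, Finset.sum_add_distrib, Finset.sum_sub_distrib, ← Finset.mul_sum,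
    ← hS, Finset.sum_const, Finset.card_range, nsmul_eq_mul]
  field_simp
  ring

variable {Ω : Type*} {mΩ : MeasurableSpace Ω} {μ : Measure Ω} [IsProbabilityMeasure μ]

/-! ### The replica mean and the between-replica statistic -/

/-- The replica (seed) mean `Ȳ = (1/R) Σ_{r<R} Y_r`. -/
noncomputable def replicaMean (Y : ℕ → Ω → ℝ) (R : ℕ) : Ω → ℝ :=
  fun ω => (∑ r ∈ range R, Y r ω) / R

/-- The between-replica squared standard error of the replica mean,
`SE² = Σ_{r<R} (Y_r − Ȳ)² / (R (R − 1))` (`= s²_R / R`; `R = 1` gives the junk value `x/0 = 0`). -/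
noncomputable def replicaSEsq (Y : ℕ → Ω → ℝ) (R : ℕ) : Ω → ℝ :=
  fun ω => (∑ r ∈ range R, (Y r ω - replicaMean Y R ω) ^ 2) / ((R : ℝ) * ((R : ℝ) - 1))

section

variable {Y : ℕ → Ω → ℝ} {R : ℕ}

omit [IsProbabilityMeasure μ] in
/-- The replica mean is square integrable. -/
theorem memLp_replicaMean (hY : ∀ r < R, MemLp (Y r) 2 μ) : MemLp (replicaMean Y R) 2 μ :=
  memLp_div_const (memLp_finsetSum (range R) fun r hr => hY r (mem_range.mp hr)) _

/-- `E Ȳ = (1/R) Σ_r E Y_r`. -/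
theorem integral_replicaMean (hY : ∀ r < R, MemLp (Y r) 2 μ) :
    μ[replicaMean Y R] = (∑ r ∈ range R, μ[Y r]) / (R : ℝ) := by
  unfold replicaMean
  rw [integral_div, integral_finsetSum]
  exact fun r hr => (hY r (mem_range.mp hr)).integrable one_le_two

/-- **`Var(Ȳ) = (1/R²) Σ_r Var(Y_r)`** for pairwise uncorrelated replicas (any means, any
variances). -/
theorem variance_replicaMean (hR : R ≠ 0) (hY : ∀ r < R, MemLp (Y r) 2 μ)
    (hcov : ∀ i < R, ∀ j < R, i ≠ j → cov[Y i, Y j; μ] = 0) :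
    Var[replicaMean Y R; μ] = (∑ r ∈ range R, Var[Y r; μ]) / (R : ℝ) ^ 2 := by
  have hR' : (R : ℝ) ≠ 0 := by exact_mod_cast hR
  have hY' : ∀ r ∈ range R, MemLp (Y r) 2 μ := fun r hr => hY r (mem_range.mp hr)
  have h1 : replicaMean Y R = fun ω => (∑ r ∈ range R, Y r) ω * (R : ℝ)⁻¹ := by
    funext ω
    simp only [replicaMean, Finset.sum_apply, div_eq_mul_inv]
  rw [h1, variance_mul_const, variance_sum' hY']
  have hdiag : ∑ i ∈ range R, ∑ j ∈ range R, cov[Y i, Y j; μ] = ∑ i ∈ range R, Var[Y i; μ] := by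
    refine Finset.sum_congr rfl fun i hi => ?_
    rw [Finset.sum_eq_single i]
    · exact covariance_self (hY' i hi).aemeasurable
    · intro j hj hji
      exact hcov i (mem_range.mp hi) j (mem_range.mp hj) (Ne.symm hji)
    · intro h; exact absurd hi h
  rw [hdiag, inv_pow, div_eq_mul_inv]

/-- `E[Y_r²] = Var(Y_r) + (E Y_r)²`. -/
theorem integral_sq_eq_variance_add (r : ℕ) (hYr : MemLp (Y r) 2 μ) :
    ∫ ω, Y r ω ^ 2 ∂μ = Var[Y r; μ] + (μ[Y r]) ^ 2 := by
  have h := variance_eq_sub hYr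
  have hp : (μ[Y r ^ 2]) = ∫ ω, Y r ω ^ 2 ∂μ := by
    simp only [Pi.pow_apply]
  rw [hp] at h
  linarith

/-- `E[Ȳ²] = Var(Ȳ) + (E Ȳ)²`. -/
theorem integral_replicaMean_sq (hY : ∀ r < R, MemLp (Y r) 2 μ) :
    ∫ ω, replicaMean Y R ω ^ 2 ∂μ = Var[replicaMean Y R; μ] + (μ[replicaMean Y R]) ^ 2 := by
  have h := variance_eq_sub (memLp_replicaMean (μ := μ) hY)
  have hp : (μ[replicaMean Y R ^ 2]) = ∫ ω, replicaMean Y R ω ^ 2 ∂μ := by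
    simp only [Pi.pow_apply]
  rw [hp] at h
  linarith

/-- **The expectation of the between-replica sum of squares.**
`E[Σ_r (Y_r − Ȳ)²] = Σ_r Var(Y_r) − R Var(Ȳ) + Σ_r (m_r − m̄)²` with `m_r = E Y_r`,
`m̄ = (Σ m_r)/R`. -/
theorem integral_sum_sq_sub_replicaMean (hR : R ≠ 0) (hY : ∀ r < R, MemLp (Y r) 2 μ) :
    ∫ ω, ∑ r ∈ range R, (Y r ω - replicaMean Y R ω) ^ 2 ∂μ
      = (∑ r ∈ range R, Var[Y r; μ]) - R * Var[replicaMean Y R; μ]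
        + ∑ r ∈ range R, (μ[Y r] - (∑ s ∈ range R, μ[Y s]) / (R : ℝ)) ^ 2 := by
  have hR' : (R : ℝ) ≠ 0 := by exact_mod_cast hR
  -- pointwise algebra
  have hpt : ∀ ω, ∑ r ∈ range R, (Y r ω - replicaMean Y R ω) ^ 2
      = ∑ r ∈ range R, Y r ω ^ 2 - R * replicaMean Y R ω ^ 2 := by
    intro ω
    unfold replicaMean
    exact sum_sq_sub_avg (fun r => Y r ω) hR
  simp_rw [hpt]
  -- integrability
  have hint_sq : ∀ r ∈ range R, Integrable (fun ω => Y r ω ^ 2) μ :=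
    fun r hr => (hY r (mem_range.mp hr)).integrable_sq
  have hint_sum : Integrable (fun ω => ∑ r ∈ range R, Y r ω ^ 2) μ :=
    integrable_finsetSum (range R) hint_sq
  have hint_m : Integrable (fun ω => (R : ℝ) * replicaMean Y R ω ^ 2) μ :=
    ((memLp_replicaMean (μ := μ) hY).integrable_sq).const_mul _
  rw [integral_sub hint_sum hint_m, integral_finsetSum _ hint_sq, integral_const_mul,
    integral_replicaMean_sq hY, integral_replicaMean hY]
  rw [Finset.sum_congr rfl fun r hr => integral_sq_eq_variance_add r (hY r (mem_range.mp hr)),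
    Finset.sum_add_distrib]
  have hmeans := sum_sq_sub_avg (fun r => μ[Y r]) hR
  rw [hmeans]
  ring

/-- **`E[SE²] = Var(Ȳ) + Σ_r (m_r − m̄)² / (R (R − 1))`** — the between-replica squared standard
error over-shoots the variance of the replica mean by exactly the spread of the TRUE replica means
(`R ≥ 2`, pairwise uncorrelated replicas). -/
theorem integral_replicaSEsq (hR : 2 ≤ R) (hY : ∀ r < R, MemLp (Y r) 2 μ)
    (hcov : ∀ i < R, ∀ j < R, i ≠ j → cov[Y i, Y j; μ] = 0) :
    μ[replicaSEsq Y R]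
      = Var[replicaMean Y R; μ]
        + (∑ r ∈ range R, (μ[Y r] - (∑ s ∈ range R, μ[Y s]) / (R : ℝ)) ^ 2)
          / ((R : ℝ) * ((R : ℝ) - 1)) := by
  have hR0 : R ≠ 0 := by omega
  have hR' : (2 : ℝ) ≤ R := by exact_mod_cast hR
  have hRne : (R : ℝ) ≠ 0 := by positivity
  have hR1 : (R : ℝ) - 1 ≠ 0 := by linarith
  unfold replicaSEsq
  rw [integral_div, integral_sum_sq_sub_replicaMean hR0 hY, variance_replicaMean hR0 hY hcov]
  field_simp

/-- **Genuine replicas (equal true means): `E[SE²] = Var(Ȳ)` — unbiased**, whatever the replica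
variances and whatever happens INSIDE each replica (autocorrelation never enters). -/
theorem integral_replicaSEsq_of_means_eq (hR : 2 ≤ R) (hY : ∀ r < R, MemLp (Y r) 2 μ)
    (hcov : ∀ i < R, ∀ j < R, i ≠ j → cov[Y i, Y j; μ] = 0) {m : ℝ}
    (hmean : ∀ r < R, μ[Y r] = m) :
    μ[replicaSEsq Y R] = Var[replicaMean Y R; μ] := by
  have hR0 : R ≠ 0 := by omega
  have hRne : (R : ℝ) ≠ 0 := by exact_mod_cast hR0
  rw [integral_replicaSEsq hR hY hcov]
  have hz : ∑ r ∈ range R, (μ[Y r] - (∑ s ∈ range R, μ[Y s]) / (R : ℝ)) ^ 2 = 0 := by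
    refine Finset.sum_eq_zero fun r hr => ?_
    have hsum : ∑ s ∈ range R, μ[Y s] = R * m := by
      rw [Finset.sum_congr rfl fun s hs => hmean s (mem_range.mp hs), Finset.sum_const,
        Finset.card_range, nsmul_eq_mul]
    rw [hmean r (mem_range.mp hr), hsum, mul_div_cancel_left₀ m hRne, sub_self]
    ring
  rw [hz, zero_div, add_zero]

/-- **Different true means: the replica error is conservative in expectation**,
`Var(Ȳ) ≤ E[SE²]`. -/
theorem variance_replicaMean_le_integral_replicaSEsq (hR : 2 ≤ R)
    (hY : ∀ r < R, MemLp (Y r) 2 μ)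
    (hcov : ∀ i < R, ∀ j < R, i ≠ j → cov[Y i, Y j; μ] = 0) :
    Var[replicaMean Y R; μ] ≤ μ[replicaSEsq Y R] := by
  have hR' : (2 : ℝ) ≤ R := by exact_mod_cast hR
  rw [integral_replicaSEsq hR hY hcov]
  have hpos : 0 < (R : ℝ) * ((R : ℝ) - 1) := by
    have h1 : (0 : ℝ) < R := by linarith
    have h2 : (0 : ℝ) < (R : ℝ) - 1 := by linarith
    positivity
  have hnn : 0 ≤ (∑ r ∈ range R, (μ[Y r] - (∑ s ∈ range R, μ[Y s]) / (R : ℝ)) ^ 2)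
      / ((R : ℝ) * ((R : ℝ) - 1)) :=
    div_nonneg (Finset.sum_nonneg fun r _ => sq_nonneg _) hpos.le
  linarith

end

end Summit.Ventures.LatticeQCDFlow.Scoring
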